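import Summits.BirchSwinnertonDyer.BirchSwinnertonDyer.Theorems.PrintCf2RubinValueTwoTwoVariableLayerRigidity
import HarnessLib

/-!
# Layer rigidity, part III: a PRIME layer relation `φ ∈ ℤ_p⟦T₂⟧` (e.g. an Eisenstein `Φ_{pⁿ}(1+T₂)`) makes `C φ` prime in `Λ₂ = ℤ_p⟦T₂⟧⟦T₁⟧`
# (`Λ₂/(C φ) ≅ (ℤ_p⟦T₂⟧/φ)⟦T₁⟧` is a domain), so the non-zero-divisor clause of THEOREM R′ reduces to `C φ ∤ A`

Cell `bsd-print-cf2`, width seat `bsd-line-cf2c-w8` g6 (prover-bsd-line-cf2c-w8-g6-0); memo `Cruxes/MainConjClauseAtSplitTwoQuad/A-BRICK-PRINT-MAP-cf2c-w8g6.md` §5.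
* `ker_map_quotientMk_eq_span_C` (coefficientwise reduction `R⟦T⟧ → (R/φ)⟦T⟧` has kernel `(C φ)`), `prime_C_of_prime` (any commutative ring `R`:
  `φ` prime ⟹ `C φ` prime in `R⟦T⟧`), `mem_span_C_of_mul_mem` (the non-zero-divisor clause from `C φ ∤ A`);
* **`span_singleton_eq_of_dvd_of_primeLayers`** — THEOREM R′ (p715747/p716015) with the layer hypothesis «`(Ā) = (B̄)` in `Λ₂/(C φ_n)` and `C φ_n ∤ A`»
  for PRIME layer relations `φ_n` (for `Φ_{pⁿ}(1+T₂)`: Eisenstein; `A` has only finitely many prime factors, so `C φ_n ∤ A` for `n ≫ 0`).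
Pure algebra; THEOREMS ONLY; no `def`, no named fact, no `sorry`. No summit statement is proved; BSD is not proved by any of this. beyond-print theorem: no.

References: [Washington1997] §7.1, §13.2; [BourbakiAlgComm] VII §3.
-/

set_option autoImplicit false
-- the summit namespace `Summit.BirchSwinnertonDyer.BirchSwinnertonDyer` repeats the problem name by design (D-0017)
set_option linter.dupNamespace false

open PowerSeries

namespace Summit.BirchSwinnertonDyer.BirchSwinnertonDyer.Theorems.PrintCf2.LayerRigidity

section PrimeC

variable {R : Type*} [CommRing R]

/-- The kernel of the coefficientwise reduction `R⟦T⟧ → (R/(φ))⟦T⟧` is `(C φ)`. [folklore] -/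
theorem ker_map_quotientMk_eq_span_C (φ : R) :
    RingHom.ker (PowerSeries.map (Ideal.Quotient.mk (Ideal.span {φ}))) = Ideal.span {C φ} := by
  ext f
  rw [RingHom.mem_ker, mem_span_C_iff, PowerSeries.ext_iff]
  refine forall_congr' fun m ↦ ?_
  rw [coeff_map, map_zero, Ideal.Quotient.eq_zero_iff_mem, Ideal.mem_span_singleton]

/-- **`φ` prime in `R` ⟹ `C φ` prime in `R⟦T⟧`** (`R⟦T⟧/(C φ) ≅ (R/φ)⟦T⟧` is a domain). [folklore] -/
theorem prime_C_of_prime {φ : R} (hφ : Prime φ) : Prime (C φ : PowerSeries R) := by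
  have hφ0 : (C φ : PowerSeries R) ≠ 0 := by
    rw [Ne, map_eq_zero_iff _ (C_injective (R := R))]; exact hφ.ne_zero
  rw [← Ideal.span_singleton_prime hφ0, ← ker_map_quotientMk_eq_span_C, ← Ideal.Quotient.isDomain_iff_prime]
  haveI : IsDomain (R ⧸ Ideal.span {φ}) := (Ideal.Quotient.isDomain_iff_prime _).mpr ((Ideal.span_singleton_prime hφ.ne_zero).mpr hφ)
  have hsurj : Function.Surjective (PowerSeries.map (Ideal.Quotient.mk (Ideal.span {φ})) : PowerSeries R →+* _) :=
    PowerSeries.map_surjective _ Ideal.Quotient.mk_surjective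
  exact (RingHom.quotientKerEquivOfSurjective hsurj).toMulEquiv.isDomain_iff.mpr inferInstance

/-- The non-zero-divisor clause of THEOREM R′ from `C φ ∤ A` for a prime `φ`. [folklore] -/
theorem mem_span_C_of_mul_mem {φ : R} (hφ : Prime φ) {A : PowerSeries R} (hA : ¬ C φ ∣ A) (x : PowerSeries R)
    (hx : A * x ∈ Ideal.span {C φ}) : x ∈ Ideal.span {C φ} := by
  rw [Ideal.mem_span_singleton] at hx ⊢
  exact ((prime_C_of_prime hφ).dvd_or_dvd hx).resolve_left hA

end PrimeC

section Rigidity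

variable {p : ℕ} [Fact p.Prime]

/-- **THEOREM R′ for PRIME layer relations.** `φ : ℕ → ℤ_p⟦T⟧` a layer family of PRIME elements (e.g. `Φ_{pⁿ}(1+T)`, Eisenstein), `A·h = p^k·B` in
`Λ₂`, and for every `n`: `(Ā) = (B̄)` as ideals of `Λ₂/(C φ_n)` and `C φ_n ∤ A` ⟹ `(A) = (B)` in `Λ₂`. [cite: Washington1997, §13.2 (shape); §7.1] -/
theorem span_singleton_eq_of_dvd_of_primeLayers (φ : ℕ → PowerSeries ℤ_[p]) (hφ : ∀ n, Prime (φ n))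
    (hφ₁ : ∀ n, PowerSeries.map (PadicInt.toZMod (p := p)) (φ n) ≠ 0)
    (hφ₂ : ∀ N : ℕ, ∃ n, (X : PowerSeries (ZMod p)) ^ N ∣ PowerSeries.map (PadicInt.toZMod (p := p)) (φ n))
    {A B h : PowerSeries (PowerSeries ℤ_[p])} {k : ℕ} (hAB : A * h = C (C ((p : ℤ_[p]) ^ k)) * B)
    (hline : ∀ n,
      Ideal.span {Ideal.Quotient.mk (Ideal.span {C (φ n)}) A} = Ideal.span {Ideal.Quotient.mk (Ideal.span {C (φ n)}) B} ∧
      ¬ C (φ n) ∣ A) :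
    Ideal.span {A} = Ideal.span {B} :=
  span_singleton_eq_of_dvd_of_layers_of_span_eq φ hφ₁ hφ₂ hAB fun n ↦
    ⟨(hline n).1, mem_span_C_of_mul_mem (hφ n) (hline n).2⟩

end Rigidity

end Summit.BirchSwinnertonDyer.BirchSwinnertonDyer.Theorems.PrintCf2.LayerRigidity
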